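import Summits.QuantumFields.BalabanUV.T4Continuum.Support.NE7EJBracketPath

/-!
# NE7EJBracketGreenMonotone — row NE7 (node U5), candidate route HOM, variant H1L-EJ: THE CONSTRAINED PROPAGATOR IS A SUPREMUM OVER THE
# FLUCTUATIONS, HENCE ORDER-REVERSING IN THE FORM — lens 2's S-91-1 §3 (i) «REAL SLICE, TWO-SIDED AND EXACT IN ORDER» for the remainder `R₂`

Lineage `b2b-balaban-t4-ne7-p2` (CRUX PROVER NE7 #2 = C-HOM°'s kernel hand), generation 80; file 113 (after 108 `NE7EJBracketForms`, 109
`NE7EJBracketPath`).  CONSUMER SHAPE (by name): lens 2's S-91-1 (`t4/ideate/NE7/lens2-g91/ENVELOPE-SUPPLY.md` §3 (i)): «REAL SLICE, TWO-SIDED AND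
EXACT IN ORDER. If m·H_* ≤ H_τ ≤ M·H_* on T S_V for τ ∈ [0,1] (H_* any fixed reference form …) then (1∕M)·∫₀¹(1−τ)‖P d𝔇(U_τ)‖²_{H_*^{−1}} dτ ≤ R₂ ≤
(1∕m)·∫₀¹(1−τ)‖P d𝔇(U_τ)‖²_{H_*^{−1}} dτ … R₂ is EXACTLY second order in the tangential first variation of the defect — «doubly small» … with the
constant named (1∕2m)».  In the quadratic model (file 108: `R₂(B) = ⟨EH₀B, G₁ EH₀B⟩`, `G = constrProp K Q` = an1's constrained propagator, the
`H^{−1}` restricted to the fluctuations `ker Q`) the comparison of `G` between two forms is what is needed, and it follows from a VARIATIONAL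
characterisation (no spectral theory):
* §1 **THE CONSTRAINED PROPAGATOR AS A SUPREMUM OVER `ker Q`**: `ker_pairing` (`y ∈ ker Q ⇒ ⟨y, K G x⟩ = ⟨y, x⟩`), `constrProp_mulVec_mem_ker`,
  **`two_mul_dot_sub_qf_le_green_form`** (`y ∈ ker Q ⇒ 2⟨x,y⟩ − ⟨y,Ky⟩ ≤ ⟨x,Gx⟩`, completing the square with `K`), `green_form_eq_sup` (equality at
  `y = Gx`) — `⟨x, G x⟩ = max_{y ∈ ker Q} (2⟨x,y⟩ − ⟨y,Ky⟩)`.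
* §2 **ORDER REVERSAL**: `green_form_antitone` (`K₁ ⪯ K₂` as forms ⇒ `G₂ ⪯ G₁` as forms), and the scaled two-sided version
  **`green_form_le_of_form_ge`** (`mH ⪯ K`, `m > 0` ⇒ `⟨x,G_K x⟩ ≤ m⁻¹⟨x,G_H x⟩`) ∕ **`green_form_ge_of_form_le`** (`K ⪯ MH`, `M > 0` ⇒
  `M⁻¹⟨x,G_H x⟩ ≤ ⟨x,G_K x⟩`).
* §3 **LENS 2's (i) FOR THE QUADRATIC BRACKET**: **`remB_forms_two_sided`** — if `mH ⪯ K₁ ⪯ MH` (forms, `0 < m`, `0 < M`, `H ≻ 0`) then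
  `M⁻¹·⟨x, G_H x⟩ ≤ R₂(B) ≤ m⁻¹·⟨x, G_H x⟩`, `x = E H₀ B` (the remainder is EXACTLY the reference-propagator size of the first variation of the
  defect, up to the window `[M⁻¹, m⁻¹]`); along the τ-line with a NON-NEGATIVE defect form (`E ⪰ 0`, e.g. the two-cutoff comparison of file 111):
  `lineK_form_window` (`K₀ ⪯ K_σ ⪯ K₀ + E` on `[0,1]`) and **`qrem_two_sided_of_defect_nonneg`** (`⟨x, G₁ x⟩ ≤ q(τ,σ) ≤ ⟨x, G₀ x⟩`, `x = E U_τB`: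
  the (E4) remainder form between the two endpoint propagators, uniformly in `σ`).

HONEST FRAMING: [folklore] (completing the square on `ker Q`); REAL forms; the window `mH ⪯ K₁ ⪯ MH` is a HYPOTHESIS (in the road it is F2∕F3's
sandwich `Hess A_c ≤ Hess A_B ≤ c₂·Hess A_c` near flat — NOT supplied here); the `∫₀¹(1−τ)…dτ` weighting of S-91-1 (i) is the continuous form
whose finite version is file 109's `lineValue_expand`; nothing of Bałaban's instantiated; NOT (N1) ∕ (N1-δ) ∕ K1-var(s) ∕ EJ-1c ∕ EJ-2 ∕ EJ-3; NOT a
letter move (desk N-45-5: tag (IV) priced, (I) stands); credit lens 2 g91.  NE7 NOT PRINTED ∕ NOT PROVED; spine 0∕9; FIXED FINITE T⁴, rung (B)+1;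
NOT infinite volume, NOT mass gap, NOT Clay.  HONEST DEPENDENCY: continuum YM on T⁴ ⇐ BetaPertH ∧ nine spine estimates (0/9 proved); BetaPertH ⇐
(D1) ∧ (D4) ∧ CAP+tail; G-an2-4 gates asym, D1 and NE2/3/4.
-/

noncomputable section

open Matrix Set

namespace Summit.QuantumFields.BalabanUV.T4Continuum.NE7EJBracketGreenMonotone

open Literature.MathematicalPhysics.QuantumFieldTheory.Balaban1983to89.Beta.Composition (blockProp)
open Literature.MathematicalPhysics.QuantumFieldTheory.Balaban1983to89.Beta.Envelope
open NE7EJBracket NE7EJBracketForms NE7EJBracketPath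

variable {ν μ : Type*} [Fintype ν] [Fintype μ] [DecidableEq ν] [DecidableEq μ]

/-! ### §1 The constrained propagator as a supremum over the fluctuations `ker Q` -/

section Sup

variable {K : Matrix ν ν ℝ} {Q : Matrix μ ν ℝ}

omit [DecidableEq ν] [DecidableEq μ] in
/-- `⟨y, Qᵀ w⟩ = ⟨Q y, w⟩`. [folklore] -/
theorem dot_transpose_mulVec (Q : Matrix μ ν ℝ) (y : ν → ℝ) (w : μ → ℝ) : y ⬝ᵥ (Qᵀ *ᵥ w) = (Q *ᵥ y) ⬝ᵥ w := by
  rw [dotProduct_mulVec, vecMul_transpose]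

/-- **THE KERNEL PAIRING**: for a fluctuation `y ∈ ker Q` and any `x`, `⟨y, K (G x)⟩ = ⟨y, x⟩` (`K G = 1 − Qᵀ Hᴸ`, an1's `mul_constrProp`).
[folklore] -/
theorem ker_pairing (hK : K.PosDef) {y : ν → ℝ} (hy : Q *ᵥ y = 0) (x : ν → ℝ) :
    y ⬝ᵥ (K *ᵥ (constrProp K Q *ᵥ x)) = y ⬝ᵥ x := by
  rw [mulVec_mulVec, mul_constrProp K Q (isUnit_det_of_posDef hK), sub_mulVec, one_mulVec, dotProduct_sub, ← mulVec_mulVec,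
    dot_transpose_mulVec, hy, zero_dotProduct, sub_zero]

/-- `G x` is a fluctuation: `Q (G x) = 0` (an1's `constraint_mul_constrProp`). [folklore] -/
theorem constrProp_mulVec_mem_ker (hK : K.PosDef) (hQ : Function.Injective Q.vecMul) (x : ν → ℝ) :
    Q *ᵥ (constrProp K Q *ᵥ x) = 0 := by
  rw [mulVec_mulVec, constraint_mul_constrProp K Q (isUnit_blockProp_det hK hQ), zero_mulVec]

/-- `⟨G x, K (G x)⟩ = ⟨x, G x⟩` (`G K G = G`, read through the kernel pairing). [folklore] -/
theorem green_qf_eq (hK : K.PosDef) (hQ : Function.Injective Q.vecMul) (x : ν → ℝ) :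
    (constrProp K Q *ᵥ x) ⬝ᵥ (K *ᵥ (constrProp K Q *ᵥ x)) = x ⬝ᵥ (constrProp K Q *ᵥ x) := by
  rw [ker_pairing hK (constrProp_mulVec_mem_ker hK hQ x), dotProduct_comm]

/-- **COMPLETING THE SQUARE ON `ker Q`**: for every fluctuation `y` (`Q y = 0`), `2⟨x, y⟩ − ⟨y, K y⟩ ≤ ⟨x, G x⟩`. [folklore] -/
theorem two_mul_dot_sub_qf_le_green_form (hK : K.PosDef) (hQ : Function.Injective Q.vecMul) {y : ν → ℝ} (hy : Q *ᵥ y = 0) (x : ν → ℝ) :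
    2 * (x ⬝ᵥ y) - y ⬝ᵥ (K *ᵥ y) ≤ x ⬝ᵥ (constrProp K Q *ᵥ x) := by
  set z := constrProp K Q *ᵥ x with hz
  have hKs := transpose_eq_of_posDef hK
  have hpos := qf_nonneg_of_posSemidef hK.posSemidef (y - z)
  have e1 : y ⬝ᵥ (K *ᵥ z) = y ⬝ᵥ x := by rw [hz]; exact ker_pairing hK hy x
  have e2 : z ⬝ᵥ (K *ᵥ z) = x ⬝ᵥ z := by rw [hz]; exact green_qf_eq hK hQ x
  have e3 : z ⬝ᵥ (K *ᵥ y) = y ⬝ᵥ (K *ᵥ z) := dotProduct_mulVec_comm K hKs z y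
  have hexp : (y - z) ⬝ᵥ (K *ᵥ (y - z)) = y ⬝ᵥ (K *ᵥ y) - 2 * (x ⬝ᵥ y) + x ⬝ᵥ z := by
    rw [mulVec_sub, dotProduct_sub, sub_dotProduct, sub_dotProduct, e3, e1, e2, dotProduct_comm y x]
    ring
  linarith

/-- and EQUALITY at the fluctuation `y = G x`: `⟨x, Gx⟩ = 2⟨x, Gx⟩ − ⟨Gx, K Gx⟩` — so `⟨x, G x⟩ = max_{Q y = 0} (2⟨x,y⟩ − ⟨y,Ky⟩)`. [folklore] -/
theorem green_form_eq_sup (hK : K.PosDef) (hQ : Function.Injective Q.vecMul) (x : ν → ℝ) :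
    x ⬝ᵥ (constrProp K Q *ᵥ x) = 2 * (x ⬝ᵥ (constrProp K Q *ᵥ x)) - (constrProp K Q *ᵥ x) ⬝ᵥ (K *ᵥ (constrProp K Q *ᵥ x)) := by
  rw [green_qf_eq hK hQ]; ring

end Sup

/-! ### §2 Order reversal: a larger form has a smaller constrained propagator -/

section Antitone

variable {K₁ K₂ K H : Matrix ν ν ℝ} {Q : Matrix μ ν ℝ}

/-- **`K₁ ⪯ K₂ ⇒ G₂ ⪯ G₁`** (as quadratic forms): the constrained propagator is order-reversing in the form. [folklore] -/
theorem green_form_antitone (hK₁ : K₁.PosDef) (hK₂ : K₂.PosDef) (hQ : Function.Injective Q.vecMul)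
    (hle : ∀ y : ν → ℝ, y ⬝ᵥ (K₁ *ᵥ y) ≤ y ⬝ᵥ (K₂ *ᵥ y)) (x : ν → ℝ) :
    x ⬝ᵥ (constrProp K₂ Q *ᵥ x) ≤ x ⬝ᵥ (constrProp K₁ Q *ᵥ x) := by
  have hy := constrProp_mulVec_mem_ker hK₂ hQ x
  have h1 := two_mul_dot_sub_qf_le_green_form hK₁ hQ hy x
  have h2 := green_form_eq_sup hK₂ hQ x
  have h3 := hle (constrProp K₂ Q *ᵥ x)
  linarith

/-- **`mH ⪯ K`, `m > 0` ⇒ `⟨x, G_K x⟩ ≤ m⁻¹·⟨x, G_H x⟩`** (test the supremum at `m·G_K x`). [folklore] -/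
theorem green_form_le_of_form_ge (hK : K.PosDef) (hH : H.PosDef) (hQ : Function.Injective Q.vecMul) {m : ℝ} (hm : 0 < m)
    (hge : ∀ y : ν → ℝ, m * (y ⬝ᵥ (H *ᵥ y)) ≤ y ⬝ᵥ (K *ᵥ y)) (x : ν → ℝ) :
    x ⬝ᵥ (constrProp K Q *ᵥ x) ≤ m⁻¹ * (x ⬝ᵥ (constrProp H Q *ᵥ x)) := by
  set y := constrProp K Q *ᵥ x with hy
  have hyk : Q *ᵥ y = 0 := constrProp_mulVec_mem_ker hK hQ x
  have hmy : Q *ᵥ (m • y) = 0 := by rw [mulVec_smul, hyk, smul_zero]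
  have h1 := two_mul_dot_sub_qf_le_green_form hH hQ hmy x
  rw [mulVec_smul, dotProduct_smul, smul_dotProduct, dotProduct_smul, smul_eq_mul, smul_eq_mul, smul_eq_mul] at h1
  have h2 := green_form_eq_sup hK hQ x
  rw [← hy] at h2
  have h3 := hge y
  -- ⟨x,G_K x⟩ = 2⟨x,y⟩ − ⟨y,Ky⟩ ≤ 2⟨x,y⟩ − m⟨y,Hy⟩ = m⁻¹(2⟨x,my⟩ − ⟨my,H my⟩) ≤ m⁻¹⟨x,G_H x⟩
  have h4 : x ⬝ᵥ y ≤ 2 * (x ⬝ᵥ y) - m * (y ⬝ᵥ (H *ᵥ y)) := by linarith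
  have h5 : m * (2 * (x ⬝ᵥ y) - m * (y ⬝ᵥ (H *ᵥ y))) ≤ x ⬝ᵥ (constrProp H Q *ᵥ x) := by nlinarith
  rw [le_inv_mul_iff₀ hm]
  nlinarith

/-- **`K ⪯ MH`, `M > 0` ⇒ `M⁻¹·⟨x, G_H x⟩ ≤ ⟨x, G_K x⟩`** (test the supremum at `M⁻¹·G_H x`). [folklore] -/
theorem green_form_ge_of_form_le (hK : K.PosDef) (hH : H.PosDef) (hQ : Function.Injective Q.vecMul) {M : ℝ} (hM : 0 < M)
    (hle : ∀ y : ν → ℝ, y ⬝ᵥ (K *ᵥ y) ≤ M * (y ⬝ᵥ (H *ᵥ y))) (x : ν → ℝ) :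
    M⁻¹ * (x ⬝ᵥ (constrProp H Q *ᵥ x)) ≤ x ⬝ᵥ (constrProp K Q *ᵥ x) := by
  set y := constrProp H Q *ᵥ x with hy
  have hyk : Q *ᵥ y = 0 := constrProp_mulVec_mem_ker hH hQ x
  have hmy : Q *ᵥ (M⁻¹ • y) = 0 := by rw [mulVec_smul, hyk, smul_zero]
  have h1 := two_mul_dot_sub_qf_le_green_form hK hQ hmy x
  rw [mulVec_smul, dotProduct_smul, smul_dotProduct, dotProduct_smul, smul_eq_mul, smul_eq_mul, smul_eq_mul] at h1
  have h2 := green_form_eq_sup hH hQ x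
  rw [← hy] at h2
  have h3 := hle y
  have hyH : y ⬝ᵥ (H *ᵥ y) = x ⬝ᵥ y := by rw [hy]; exact green_qf_eq hH hQ x
  -- 2 M⁻¹⟨x,y⟩ − M⁻²⟨y,Ky⟩ ≥ 2M⁻¹⟨x,y⟩ − M⁻¹⟨y,Hy⟩ = M⁻¹⟨x,y⟩
  have hMi : 0 < M⁻¹ := inv_pos.mpr hM
  have h4 : M⁻¹ * (M⁻¹ * (y ⬝ᵥ (K *ᵥ y))) ≤ M⁻¹ * (y ⬝ᵥ (H *ᵥ y)) := by
    apply mul_le_mul_of_nonneg_left _ hMi.le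
    rw [inv_mul_le_iff₀ hM]; exact h3
  rw [hyH] at h4
  linarith

end Antitone

/-! ### §3 Lens 2's (i): the remainder two-sided in a reference propagator; the τ-line with a non-negative defect -/

section TwoSided

variable {K₀ K₁ H E : Matrix ν ν ℝ} {Q : Matrix μ ν ℝ}

/-- **LENS 2's (i) FOR THE QUADRATIC BRACKET**: if `mH ⪯ K₁ ⪯ MH` (as forms, `0 < m`, `0 < M`, `H ≻ 0`) then
`M⁻¹·⟨x, G_H x⟩ ≤ R₂(B) ≤ m⁻¹·⟨x, G_H x⟩` with `x = E H₀B`, `E = K₁ − K₀` — the remainder is the reference-propagator size of the first variation of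
the defect at run A's minimiser, up to the window. [folklore] -/
theorem remB_forms_two_sided (hK₀ : K₀.PosDef) (hK₁ : K₁.PosDef) (hH : H.PosDef) (hQ : Function.Injective Q.vecMul) {m M : ℝ} (hm : 0 < m)
    (hM : 0 < M) (hge : ∀ y : ν → ℝ, m * (y ⬝ᵥ (H *ᵥ y)) ≤ y ⬝ᵥ (K₁ *ᵥ y)) (hle : ∀ y : ν → ℝ, y ⬝ᵥ (K₁ *ᵥ y) ≤ M * (y ⬝ᵥ (H *ᵥ y)))
    (B : μ → ℝ) :
    M⁻¹ * (((K₁ - K₀) *ᵥ (minMap K₀ Q *ᵥ B)) ⬝ᵥ (constrProp H Q *ᵥ ((K₁ - K₀) *ᵥ (minMap K₀ Q *ᵥ B)))) ≤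
        remB (qf K₁) (minMap K₀ Q *ᵥ B) (minMap K₁ Q *ᵥ B) ∧
      remB (qf K₁) (minMap K₀ Q *ᵥ B) (minMap K₁ Q *ᵥ B) ≤
        m⁻¹ * (((K₁ - K₀) *ᵥ (minMap K₀ Q *ᵥ B)) ⬝ᵥ (constrProp H Q *ᵥ ((K₁ - K₀) *ᵥ (minMap K₀ Q *ᵥ B)))) := by
  rw [remB_forms_eq_green hK₀ hK₁ hQ]
  exact ⟨green_form_ge_of_form_le hK₁ hH hQ hM hle _, green_form_le_of_form_ge hK₁ hH hQ hm hge _⟩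

omit [Fintype μ] [DecidableEq ν] [DecidableEq μ] in
/-- along the τ-line with a NON-NEGATIVE defect form: `K₀ ⪯ K_σ ⪯ K₀ + E` for `σ ∈ [0,1]`. [folklore] -/
theorem lineK_form_window (hE : ∀ v : ν → ℝ, 0 ≤ v ⬝ᵥ (E *ᵥ v)) {σ : ℝ} (hσ : σ ∈ Icc (0:ℝ) 1) (y : ν → ℝ) :
    y ⬝ᵥ (K₀ *ᵥ y) ≤ y ⬝ᵥ (lineK K₀ E σ *ᵥ y) ∧ y ⬝ᵥ (lineK K₀ E σ *ᵥ y) ≤ y ⬝ᵥ ((K₀ + E) *ᵥ y) := by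
  have h := hE y
  rw [lineK_apply, add_mulVec, dotProduct_add, smul_mulVec, dotProduct_smul, smul_eq_mul, add_mulVec, dotProduct_add]
  constructor <;> nlinarith [hσ.1, hσ.2]

/-- **THE (E4) REMAINDER FORM BETWEEN THE ENDPOINT PROPAGATORS** (non-negative defect, e.g. the two-cutoff comparison): for `τ`, `σ ∈ [0,1]`,
`⟨x, G₁ x⟩ ≤ q(τ,σ) ≤ ⟨x, G₀ x⟩` with `x = E U_τB`, `G₀ = G(K₀)`, `G₁ = G(K₀ + E)` — uniformly in `σ`. [folklore] -/
theorem qrem_two_sided_of_defect_nonneg (h0 : K₀.PosDef) (h1 : (K₀ + E).PosDef) (hQ : Function.Injective Q.vecMul)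
    (hE : ∀ v : ν → ℝ, 0 ≤ v ⬝ᵥ (E *ᵥ v)) (B : μ → ℝ) (τ : ℝ) {σ : ℝ} (hσ : σ ∈ Icc (0:ℝ) 1) :
    (E *ᵥ lineMin K₀ E Q B τ) ⬝ᵥ (constrProp (K₀ + E) Q *ᵥ (E *ᵥ lineMin K₀ E Q B τ)) ≤ qrem K₀ E Q B τ σ ∧
      qrem K₀ E Q B τ σ ≤ (E *ᵥ lineMin K₀ E Q B τ) ⬝ᵥ (constrProp K₀ Q *ᵥ (E *ᵥ lineMin K₀ E Q B τ)) := by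
  have hσ' := lineK_posDef h0 h1 hσ
  rw [qrem_apply]
  exact ⟨green_form_antitone hσ' h1 hQ (fun y => (lineK_form_window hE hσ y).2) _,
    green_form_antitone h0 hσ' hQ (fun y => (lineK_form_window hE hσ y).1) _⟩

end TwoSided

end Summit.QuantumFields.BalabanUV.T4Continuum.NE7EJBracketGreenMonotone

end
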